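import Summits.AtomisticToContinuum.Crystallization.Theorems.ChargedEnergyGapRidgeAtlas
import Summits.AtomisticToContinuum.Crystallization.Theorems.ChargedEnergyGapCostCell
import Summits.AtomisticToContinuum.Crystallization.Theorems.ChargedEnergyGapBulkCarrier
import Summits.AtomisticToContinuum.Crystallization.Theorems.ChargedEnergyGapRhoCovariantA
import HarnessLib

/-!
# ChargedEnergyGap · NODE 120 «ZeroZoneSplit» — the ZERO-ROOF ZONE LAW `LAW⁺(zeroBox)` of the 14231 residual, cut at `C* = 259/2`
# into an ANALYTIC high part (roof ≡ 0 by a finite cone certificate, C-uniform by homogeneity) and a STATION low part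

decomp-a2c lens-5 g120 (technique lens «finite/base range + asymptotic regime + bridge»).  Imports tree …RidgeAtlas (p-landed 113R:
`boxLaw_of_boxes`, `zeroBox`), …CostCell (113U: `feetHoleCost_le_of_roofVal_le`), …RhoCovariantA (113V: `domCapK_nonneg`), …BulkCarrier (`smoothStep_lt_one`) + HarnessLib.

TARGET (verbatim, the `zeroBox` member of `hzones` in 113S `stencilChartLawQ_designate_of_residual7`):
  `LAW⁺(zeroBox, u)` = `BoxLawP 130 u zeroBox` below (the 113P/113R box-law binder block), `zeroBox = ⟨679/1000, 691/1000, 124513/1000,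
  52417/400, 124513/1000, 130691/1000, 49941/400, 130691/1000⟩` (`C = dt 0 ∈ [124.8525, 130.691]`, cap floor `45·u` active since `chargeDepth ≥ C ≥ 241/2`).

THE CUT (lens-5 question «where must the finite STATION range end and the analytic argument begin?» — answered BY THE MATHEMATICS):
  `C* = 259/2 = 129.5`.  Above `C*` the roof of every admissible weight sextuple is EXACTLY ZERO (zero-cost members of `T75` represent it), so
  the cost is `0 ≤ domCapK` with NO magnitude / cap analysis at all; below `C*` (down to the zone floor 124.8525) the roof is positive on part
  of the admissible region (max measured cost/cap 0.731 at C = 124.8525, 0.118 at C = 128, 0 from C = 128.5; the exact zero threshold is the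
  cube-direction boundary κ₀ ∈ (0.9094, 0.9108) of NODE 103, met by the configuration (C−ρ)⁴ × (Ĉ, Ĉ) at C ≈ 128.45; `C* = 129.5` keeps a
  0.6 % ratio margin for the outward-rounded linearisation below).

  Target ⟸ (Z-lo) `BoxLawP 130 u zeroLoBox`  [WEAKER · INSTRUMENTABLE: stations (lens-3 RESIDUAL-v7 (f)) or priced-basis certificates, margin ≥ 27 %]
         ∧ (Z-hi) `BoxLawP 130 u zeroHiBox`  [WEAKER · ATTACKABLE, and further reduced here:]
             (Z-hi) ⟸ (K) `ZeroConeCover`   [WEAKER · ATTACKABLE: a FINITE certificate about the table `T75` only — the roof vanishes on the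
                                              C-free product region `m·P³` (`P` a planar quadrilateral per axis); by convexity of the roof it is
                                              decided at the 64 corners, each by one zero-cost representation (desk exact LP: 64/64 corners
                                              roof 0; 0 / 2 570 corner-biased samples positive; zero-cost generators gen 6, 11, 17, 22, 52, 81, 134)]
                    ∧ (G) `ZeroHiEnclosure`  [WEAKER · ATTACKABLE (routine): admissible tuples of `zeroHiBox` have `vtxW ∈ RegionHi (φ(C−ρ))` —
                                              five rows per axis from tree lemmas `centre_upper_of_chart`, `vertex_le_centre_add`,
                                              `sq_pole_true_le`, `sq_poles_le_of_chart` (⇒ T_a + F_a ≤ 2Ĉ) + `depthProfile_monotone` +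
                                              NODE 97 `depthProfile_convexOn` + the PROFILE RATIO LAW (P) at the band end x₀ = 128809/1000]
             support (P) `ProfileRatioLaw`   [WEAKER · PROVED in the companion file `ChargedEnergyGapPhiLogConcave.lean` (NODE 120-P):
                                              `φ(x+a)·φ(y) ≤ φ(y+a)·φ(x)` for `120 ≤ y ≤ x`, `0 ≤ a`, `x + a ≤ 160` — log-concavity of
                                              `φ = depthProfile 160` on `[120,160]` from concavity of `1 − S₇(2 − d/80)`]
  Bridges (PROVED here, 0 sorry): `zeroBoxLaw_of_split : Z-lo → Z-hi → LAW⁺(zeroBox)` (113R `boxLaw_of_boxes` on the checked C-split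
  `zeroSplit`), `zeroHiBoxLaw_of_cover : K → G → Z-hi` (roof ≤ 0 ⇒ cost ≤ 0 ≤ cap), `zeroBoxLaw_of_pieces : Z-lo → K → G → LAW⁺(zeroBox)`.

WHY EACH PIECE IS STRICTLY WEAKER (no COSTUME): Z-lo / Z-hi are the zone law restricted to the sub-boxes `C ≤ 259/2` / `C ≥ 259/2` (neither
gives the other); K speaks of the roof table only (no geometry, no ρ, no C, no cap), G of the stencil geometry only (no roof, no cap), P of the
profile only.  None is the target re-worded; K and G are each implied by nothing in the tree (K is a new finite certificate; G a new enclosure).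

WHY NOVEL (relative to the cell's cone — lens-3 box/slot cells + stations, census tile units, 113Q closed forms): the LEVER is HOMOGENEITY —
`roofVal T75` is positively 1-homogeneous in `W` and the admissible weight region, divided by `m = φ(C − ρ)`, is C-UNIFORM up to pairwise RATIO
constants which the log-concavity of `φ` (P) pins at the two ends of the C-band by single two-point evaluations.  Absolute slot boxes (113U cells,
RESIDUAL-v7 zeroBox row: «slot-box corner lemma fails at zero width below T₀ 127.4») conflate the common C-drift of all six weights (ratio 1.19
across ±ρ) with their SPREAD, so cells must have C-width ≲ 0.05 (bf97g/h: w = 0.1 ⇒ ratio 1.311 FAIL) — thousands of cells, i.e. station territory;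
in ratio coordinates the whole band `C ∈ [129.5, 130.691]` is ONE finite certificate with ZERO prices (64 corner representations).  The sphere row is
essential (without it the box+Lipschitz region has cost/cap up to 1.27 at C ≥ 128.5, desk `zz6.py`); it enters only through the linear DEPTH row
`T_a + F_a ≤ 2Ĉ`, transported to weight space by the CONVEXITY of `φ` (NODE 97) — a rectangular staircase linearisation is FALSE at 4 pieces
(desk `zz12.py`: corner (1.0777, 1.1254) of piece [−0.25, −0.1] has roof 1.6e-4) and would need ≈ 10 pieces per axis.

[NODE: 3 leaves (Z-lo INSTRUMENTABLE, K ATTACKABLE, G ATTACKABLE) + 1 support (P, PROVED in the companion file); 3 bridge theorems PROVED, 0 sorry;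
no `instance`/`notation`/`set_option`; every decision `decide +kernel`.  Memo: HOME/decomp-a2c-lens-5/g120/memo/ZEROZONE-g120.md (numbers, scripts).]
-/

namespace Summit.AtomisticToContinuum.Crystallization.Theorems.ChargedEnergyGapChartDial

open scoped Classical
open Literature.MathematicalPhysics.StatisticalMechanics Literature.Geometry.DiscreteGeometry
open Summit.AtomisticToContinuum.Crystallization.Theses.PricedLinkCensus
open Summit.AtomisticToContinuum.Crystallization.Theorems.ChargedEnergyGapNegative

namespace ZeroZone

/-! ## §120.1 The box law predicate and the cut at `C* = 259/2` -/

/-- ★ `LAW⁺(A, u)` at depth dial `dK`: the 113P/113R BOX LAW binder block (verbatim the `hlaws` clause of `boxLaw_of_boxes`). -/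
def BoxLawP (dK u : ℚ) (A : GBox) : Prop :=
  ∀ ρ : ℝ, (A.r0 : ℝ) ≤ ρ → ρ ≤ A.r1 → ∀ dt : (Fin 3 → ℤ) → ℝ,
    (A.t0 : ℝ) ≤ dt (holeVertex 0 (0, true)) → dt (holeVertex 0 (0, true)) ≤ A.t1 →
    (A.f0 : ℝ) ≤ dt (holeVertex 0 (0, false)) → dt (holeVertex 0 (0, false)) ≤ A.f1 → (A.c0 : ℝ) ≤ dt 0 → dt 0 ≤ A.c1 →
    IsChartRealisable ρ dt → (∀ p ∈ stencil 0, 0 < dt p) → poleSum dt 0 ≤ poleSum dt 1 → poleSum dt 0 ≤ poleSum dt 2 →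
    (∀ a : Fin 3, dt (holeVertex 0 (a, true)) ≤ dt (holeVertex 0 (a, false))) → IsTupleHole (dK : ℝ) ρ dt →
    feetHoleCost 160 (3 / 100) ρ dt 0 ≤ domCapK u 160 (3 / 100) ρ (chargeDepth ρ dt 0)

/-- ★ Z-lo box: `zeroBox ∩ {C ≤ 259/2}` (T₀-range clipped to `≤ 259/2 − 679/2000`). STATION / priced-basis part. -/
def zeroLoBox : GBox := ⟨679 / 1000, 691 / 1000, 124513 / 1000, 1291605 / 10000, 124513 / 1000, 130691 / 1000, 49941 / 400, 259 / 2⟩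

/-- ★ Z-hi box: `zeroBox ∩ {C ≥ 259/2}` (T₀, F₀ clipped to `≥ 259/2 − 691/1000`, `T₀ ≤ 130691/1000 − 679/2000`). ANALYTIC (zero-roof) part. -/
def zeroHiBox : GBox := ⟨679 / 1000, 691 / 1000, 128809 / 1000, 1303515 / 10000, 128809 / 1000, 130691 / 1000, 259 / 2, 130691 / 1000⟩

/-- The C-split of `zeroBox` at `259/2`. -/
def zeroSplit : BoxTree := .splitC (259 / 2) (.box 0) (.box 1)

/-- The split checks (exact ℚ, kernel decision): both clipped halves lie in `zeroLoBox` / `zeroHiBox`. -/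
theorem zeroSplit_check : zeroSplit.check 130 [zeroLoBox, zeroHiBox] zeroBox = true := by decide +kernel

/-- ★★ BRIDGE 1 (PROVED): the two half-zone laws give `LAW⁺(zeroBox)`. -/
theorem zeroBoxLaw_of_split {u : ℚ} (hlo : BoxLawP 130 u zeroLoBox) (hhi : BoxLawP 130 u zeroHiBox) : BoxLawP 130 u zeroBox :=
  boxLaw_of_boxes zeroBox (by norm_num [zeroBox]) [zeroLoBox, zeroHiBox] zeroSplit zeroSplit_check (by
    intro B hB
    simp only [List.mem_cons, List.mem_nil_iff, or_false] at hB
    rcases hB with rfl | rfl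
    · exact hlo
    · exact hhi)

/-! ## §120.2 The C-free weight region of the high part and the two leaves K, G -/

/-- ★ `RegionHi m W`: the C-FREE polyhedral enclosure of the admissible weight sextuples of the high part, in units of `m = φ(C − ρ)` —
per axis `a` the planar quadrilateral `P·m`, `P = conv{(1,1), (1,R1), (R3,R3), (R3,S−R3)}` in the `(W(a,T), W(a,F))`-plane, cut out by FIVE rows:
scale `m ≤ W(a,T)` (113C `centre_upper_of_chart` + `φ` monotone), pole order `W(a,T) ≤ W(a,F)`, shallow-pole cap `W(a,T) ≤ R3·m`
(`T_a² ≤ C²+ρ²`, 113M `sq_pole_true_le`, + ratio law P), deep-pole cap `W(a,F) ≤ R1·m` (`F_a ≤ C+ρ`, 113M `vertex_le_centre_add`, + P: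
companion `ratioRow_R1`), PAIR-SUM row `W(a,T) + W(a,F) ≤ S·m` (`T_a + F_a ≤ 2Ĉ` from 113M `sq_poles_le_of_chart`, + CONVEXITY of `φ` on
`[80,134]` (NODE 97 `depthProfile_convexOn`: the more spread pair `(C−ρ, 2Ĉ−C+ρ)` has the larger `φ`-sum) + P).  Constants (zone-uniform over
`C ∈ [259/2, 130.691]`, `ρ ∈ [0.679, 0.691]`, rounded OUTWARD to 1e-4; exact sups 1.091360 / 1.186243 / 2.186243):
`R3 = 10914/10000`, `R1 = 11863/10000`, `S = 21863/10000`.  NO cross-axis rows are needed (desk: adjacent-Lipschitz rows are redundant for the cover). -/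
def RegionHi (m : ℝ) (W : Fin 3 × Bool → ℝ) : Prop :=
  ∀ a : Fin 3, m ≤ W (a, true) ∧ W (a, true) ≤ W (a, false) ∧ W (a, true) ≤ (10914 / 10000 : ℝ) * m ∧
    W (a, false) ≤ (11863 / 10000 : ℝ) * m ∧ W (a, true) + W (a, false) ≤ (21863 / 10000 : ℝ) * m

/-- ★★★ LEAF K «ZeroConeCover» [ATTACKABLE — a finite certificate about the table `T75` ONLY]: on the region the roof VANISHES.
CERTIFICATE SHAPE (desk-verified, memo §3): `roofVal T75` is convex (106 `roofVal_convex_comb`) and the region is `m·(P × P × P)` with `P` a planar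
quadrilateral, so it suffices that the roof vanishes at the `4³ = 64` corner sextuples `m·(v_0, v_1, v_2)`, `v_a ∈ {(1,1), (1,R1), (R3,R3), (R3,S−R3)}`
— each by ONE explicit zero-cost representation (`roofVal_T75_le_of_repr`, six zero-cost members, generators among gen 6/11/17/22/52/81/134;
desk exact LP: 64/64 corners have roof 0) — plus the planar barycentric split of `P` into two triangles per axis. -/
def ZeroConeCover : Prop := ∀ m : ℝ, 0 < m → ∀ W : Fin 3 × Bool → ℝ, RegionHi m W → roofVal T75 W ≤ 0

/-- ★★★ LEAF G «ZeroHiEnclosure» [ATTACKABLE — stencil geometry + profile ratio law]: admissible tuples of the high part have their vertex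
weights in `RegionHi (φ(C − ρ))`. -/
def ZeroHiEnclosure : Prop :=
  ∀ ρ : ℝ, (zeroHiBox.r0 : ℝ) ≤ ρ → ρ ≤ zeroHiBox.r1 → ∀ dt : (Fin 3 → ℤ) → ℝ,
    (zeroHiBox.t0 : ℝ) ≤ dt (holeVertex 0 (0, true)) → dt (holeVertex 0 (0, true)) ≤ zeroHiBox.t1 →
    (zeroHiBox.f0 : ℝ) ≤ dt (holeVertex 0 (0, false)) → dt (holeVertex 0 (0, false)) ≤ zeroHiBox.f1 →
    (zeroHiBox.c0 : ℝ) ≤ dt 0 → dt 0 ≤ zeroHiBox.c1 →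
    IsChartRealisable ρ dt → (∀ p ∈ stencil 0, 0 < dt p) → poleSum dt 0 ≤ poleSum dt 1 → poleSum dt 0 ≤ poleSum dt 2 →
    (∀ a : Fin 3, dt (holeVertex 0 (a, true)) ≤ dt (holeVertex 0 (a, false))) → IsTupleHole ((130 : ℚ) : ℝ) ρ dt →
    RegionHi (depthProfile 160 (dt 0 - ρ)) (vtxW 160 dt 0)

/-- ★ SUPPORT P «ProfileRatioLaw» [PROVED in the companion NODE 120-P file as `depthProfile_ratio_le`]: log-concavity of `φ` on `[120, 160]`
in two-point form — the farther pair has the smaller ratio. -/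
def ProfileRatioLaw : Prop :=
  ∀ x y a : ℝ, 120 ≤ y → y ≤ x → 0 ≤ a → x + a ≤ 160 →
    depthProfile 160 (x + a) * depthProfile 160 y ≤ depthProfile 160 (y + a) * depthProfile 160 x

/-- The scale `m = φ(C − ρ)` of an admissible tuple of the high part is positive (`C − ρ > 80`). -/
theorem scale_pos {ρ C : ℝ} (hρ : ρ ≤ 691 / 1000) (hC : (259 / 2 : ℝ) ≤ C) : 0 < depthProfile 160 (C - ρ) := by
  unfold depthProfile
  have hlt : smoothStep (2 - 2 * (C - ρ) / 160) < 1 := smoothStep_lt_one (by linarith)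
  have h1 : 0 < 1 - smoothStep (2 - 2 * (C - ρ) / 160) := by linarith
  positivity

/-- ★★ BRIDGE 2 (PROVED): cone cover + enclosure give the HIGH-PART LAW — the roof vanishes, so the cost is `0 ≤ domCapK`. -/
theorem zeroHiBoxLaw_of_cover {u : ℚ} (hu : 0 ≤ u) (hK : ZeroConeCover) (hG : ZeroHiEnclosure) : BoxLawP 130 u zeroHiBox := by
  intro ρ e0 e1 dt t0 t1 f0 f1 c0 c1 hreal hpos hch1 hch2 hchp hhole
  have hR := hG ρ e0 e1 dt t0 t1 f0 f1 c0 c1 hreal hpos hch1 hch2 hchp hhole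
  have hρ1 : ρ ≤ 691 / 1000 := le_trans e1 (by norm_num [zeroHiBox])
  have hρ0 : 0 ≤ ρ := le_trans (by norm_num [zeroHiBox]) e0
  have hC : (259 / 2 : ℝ) ≤ dt 0 := le_trans (by norm_num [zeroHiBox]) c0
  have h0 : roofVal T75 (vtxW 160 dt 0) ≤ 0 := hK _ (scale_pos hρ1 hC) _ hR
  have hc := feetHoleCost_le_of_roofVal_le (ϱ := 160) (τ := 3 / 100) (by norm_num) hρ0 le_rfl h0
  have hcap := domCapK_nonneg (show (0 : ℝ) ≤ (u : ℝ) by exact_mod_cast hu) 160 (3 / 100) ρ (chargeDepth ρ dt 0)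
  rw [mul_zero] at hc
  exact hc.trans hcap

/-- ★★★ BRIDGE 3 (PROVED): the node's assembly — `Z-lo → K → G → LAW⁺(zeroBox, u)` for any unit `u ≥ 0`
(14231 uses `u = 1/60000000`; the `zeroBox` member of `hzones` in 113S `stencilChartLawQ_designate_of_residual7`). -/
theorem zeroBoxLaw_of_pieces {u : ℚ} (hu : 0 ≤ u) (hlo : BoxLawP 130 u zeroLoBox) (hK : ZeroConeCover) (hG : ZeroHiEnclosure) :
    BoxLawP 130 u zeroBox :=
  zeroBoxLaw_of_split hlo (zeroHiBoxLaw_of_cover hu hK hG)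

/-- [bookkeeping] the assembled law in the literal binder form of the 113S `hzones` clause for `B = zeroBox`, `u = 1/60000000`. -/
theorem zeroBox_hzone (hlo : BoxLawP 130 (1 / 60000000) zeroLoBox) (hK : ZeroConeCover) (hG : ZeroHiEnclosure) :
    ∀ ρ : ℝ, (zeroBox.r0 : ℝ) ≤ ρ → ρ ≤ zeroBox.r1 → ∀ dt : (Fin 3 → ℤ) → ℝ,
      (zeroBox.t0 : ℝ) ≤ dt (holeVertex 0 (0, true)) → dt (holeVertex 0 (0, true)) ≤ zeroBox.t1 →
      (zeroBox.f0 : ℝ) ≤ dt (holeVertex 0 (0, false)) → dt (holeVertex 0 (0, false)) ≤ zeroBox.f1 → (zeroBox.c0 : ℝ) ≤ dt 0 → dt 0 ≤ zeroBox.c1 →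
      IsChartRealisable ρ dt → (∀ p ∈ stencil 0, 0 < dt p) → poleSum dt 0 ≤ poleSum dt 1 → poleSum dt 0 ≤ poleSum dt 2 →
      (∀ a : Fin 3, dt (holeVertex 0 (a, true)) ≤ dt (holeVertex 0 (a, false))) → IsTupleHole ((130 : ℚ) : ℝ) ρ dt →
      feetHoleCost 160 (3 / 100) ρ dt 0 ≤ domCapK ((1 / 60000000 : ℚ) : ℝ) 160 (3 / 100) ρ (chargeDepth ρ dt 0) :=
  zeroBoxLaw_of_pieces (by norm_num) hlo hK hG

end ZeroZone

end Summit.AtomisticToContinuum.Crystallization.Theorems.ChargedEnergyGapChartDial
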